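import Summits.AnomalousDissipation.AnomalousDissipation.Theorems.SawtoothPulseCascadeK1LocalisedCascadeCanonicalStripStepsOsc
import Summits.AnomalousDissipation.AnomalousDissipation.Theorems.SawtoothPulseCascadeK1LocalisedCascadeStripBlocksCT
import Summits.AnomalousDissipation.AnomalousDissipation.Theorems.SawtoothPulseCascadeK1LocalisedCascadeCanonicalRatioStepsCT

/-!
# K1loc — helper: THE STRIP AND LOW-FIBRE STEPS ON CANONICAL BLOCKS, CORNER-TRACE GRADE (generic lower cut-off, closed-form junk)

Helper file of the prover lane on the crux `K1LocalisedCascade` (stmt-AnomalousDissipation-19491), route `SawtoothPulseCascade`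
(S-D seat, arbiter A24-4: the phase-3 CT ledger, concrete layer; 1:1 port of ad-k1loc-p2's `…CanonicalStripStepsOsc` over
`…StripBlocksCT`).  The strip step (S-V) and the low-fibre step (T-H) of `…StripBlocksCT` on the CANONICAL geometry
(`Λ_m = Λ₀2^m`, `Q₂^m = ⌊q_nΛ_m/q_d⌋`, generic `Q₁^m < Q₂^m` with the feed inclusion and `r_m ≤ r*`; box trapezoid with plateau
`L_m = Q₁^m`, ramp `R_m = Q₂^m − Q₁^m`), every per-block scalar DISCHARGED: gap floor `D_m ≥ D₀2^m`,
`D₀ = ((Gq_d − q_n)Λ₀ − Kq_d)/q_d` (`…CanonicalBlocksLog.canon_strip_den_ge`), fibre span `D_m + Q₂^m = Λ_mG − K ≥ S₀2^m`,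
`S₀ = Λ₀G − K`, lobe `Q₂^m ≤ q₀2^m`, `q₀ = q_nΛ₀/q_d`, lobe/gap ratio `ϑ = q₀/D₀ = q_nΛ₀/((Gq_d − q_n)Λ₀ − Kq_d)`, rounding scale
`Λ_{m+1}G = Λ₀G·2^{m+1}`; the junk is the closed form of `…BlockJunkCT.blockJunk_ct_sum_le`:
  `strip ≤ exact + ((√J₁ + √J₂ + √feed)² + tail²)`,
  `J₁ = (6N²r*(4/(3S₀²) + 2/(NS₀)) + 12N²ϑ²(4q₀/(NS₀²) + 4/(3S₀²) + 2/(NS₀) + M_b·2q₀/(N²S₀)))/π²`,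
  `J₂ = (4/3)(πΛ₀Gε2^{M_b}/N)² + M_b·(8Mδ_j·r*/π)`,
zone parameter `M ≥ 1` with `Mδ_j < π/2` and rounding `ε ≥ e^{−M²/2}` (`N = N_j`).

* `strip_vstep_canonicalCT_le` (S-V), `lowFibre_hstep_canonicalCT_le` (T-H).

No definitions; no statement about the crux. [cite: Grafakos2014, Prop. 3.1.2 (5), Prop. 3.2.7 (3), §3.1.3] [problem: turb]
-/

-- `Summit.<Summit>.<Problem>`: single-conjunct summit, the duplicate namespace segment is deliberate.
set_option linter.dupNamespace false

noncomputable section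

namespace Summit.AnomalousDissipation.AnomalousDissipation.Theorems.SawtoothPulseCascade.K1Window

open MeasureTheory Set Filter Topology UnitAddTorus Function Complex Metric
open scoped Real ENNReal
open Literature.Analysis Literature.Analysis.FunctionSpaces Literature.Analysis.FunctionSpaces.Torus Literature.Analysis.FluidPDE
open Literature.Analysis.FluidPDE.ShearStage
open Literature.Analysis.FluidPDE.SawtoothCascade Literature.Analysis.FluidPDE.SawtoothCascade.CascadeParams
open Summit.AnomalousDissipation.AnomalousDissipation.Theorems.SawtoothPulseCascade.K1Start
open Summit.AnomalousDissipation.AnomalousDissipation.Theorems.SawtoothPulseCascade.K1Flat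
open Summit.AnomalousDissipation.AnomalousDissipation.Theorems.SawtoothPulseCascade.K1Ledger.From

section Cascade

variable (P : CascadeParams)

/-! ## §1 The strip (S-V) on canonical blocks -/

/-- **(S-V) ON CANONICAL BLOCKS, CT GRADE.**  The strip `Σ'[|k₀| < K]‖𝓕a_{j+1}‖²`: the low fibres `|k₁| < Λ₀` pass exactly,
the chopped fibres are cut into canonical blocks from the floor `Λ₀ ≥ 1` with margin `q_n/q_d`, `Kq_d + q_nΛ₀ < Gq_dΛ₀`; feed slope
`(u′, v′)`, lower cut-offs `Q₁^m < Q₂^m` (feed inclusion, `Y ≤ Q₁^m + 1`, `r_m ≤ r*`), `M_b` blocks, zone parameter `M ≥ 1` with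
`Mδ_j < π/2`, rounding `ε ≥ e^{−M²/2}`.  Then `strip ≤ Σ'[|k₁| < Λ₀]‖𝓕b_j‖² + ((√J₁ + √J₂ + √(Σ'[Y ≤ |k₀| ∧ u′|k₁| ≤ v′|k₀|]‖𝓕b_j‖²))² +
((1+γ)^{2(j+1)}/(Λ₀2^{M_b}))²)` with `J₁`, `J₂` as in the file header (`S₀ = Λ₀G − K`, `q₀ = q_nΛ₀/q_d`,
`ϑ = q_nΛ₀/((Gq_d − q_n)Λ₀ − Kq_d)`). [cite: Grafakos2014, Prop. 3.1.2 (5), Prop. 3.2.7 (3), §3.1.3] -/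
theorem strip_vstep_canonicalCT_le {G : ℕ} (hγ : P.γ = G) (hδ₀ : 0 < P.δ₀) (hd : 0 < P.d) (hN₀ : 1 ≤ P.N₀)
    (hρN : 1 ≤ P.ρN) (a b : ℕ → UnitAddTorus (Fin 2) → ℝ) (has : ∀ j, IsSmooth (a j)) (h0 : a 0 = datum)
    (hb : ∀ j, b j = a j ∘ shearMap 0 1 (amp ⟨P.U j, P.U_periodic j, P.contDiff_U (P.δ_pos hδ₀ hd j)⟩ P.γ))
    (hab : ∀ j, a (j + 1) = b j ∘ shearMap 1 0 (amp ⟨P.U j, P.U_periodic j, P.contDiff_U (P.δ_pos hδ₀ hd j)⟩ P.γ))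
    (j : ℕ) {K u' v' Y qn qd Λ0 : ℕ} (hqd : 0 < qd)
    (hK : K * qd + qn * Λ0 < G * qd * Λ0) (hΛ0 : 1 ≤ Λ0)
    (Q₁ : ℕ → ℕ) (hQ : ∀ m, Q₁ m < qn * (Λ0 * 2 ^ m) / qd)
    (hfeed : ∀ m, u' * (Λ0 * 2 ^ (m + 1)) ≤ v' * (Q₁ m + 1)) {rs : ℝ}
    (hr : ∀ m, (((Q₁ m : ℕ) : ℝ) + ((qn * (Λ0 * 2 ^ m) / qd : ℕ) : ℝ)) /
      (((qn * (Λ0 * 2 ^ m) / qd : ℕ) : ℝ) - ((Q₁ m : ℕ) : ℝ)) ≤ rs)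
    (hY : ∀ m, Y ≤ Q₁ m + 1) (Mb : ℕ) {M ε : ℝ} (hM : 1 ≤ M) (hMδ : M * P.δ j < π / 2)
    (hε : Real.exp (-(M ^ 2 / 2)) ≤ ε) :
    ∑' k : Fin 2 → ℤ, (if |k 0| < (K : ℤ) then (1 : ℝ) else 0) * ‖mFourierCoeff (fun x => (a (j + 1) x : ℂ)) k‖ ^ 2 ≤
      ∑' k : Fin 2 → ℤ, (if |k 1| < (Λ0 : ℤ) then (1 : ℝ) else 0) * ‖mFourierCoeff (fun x => (b j x : ℂ)) k‖ ^ 2 +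
      ((Real.sqrt ((6 * (P.N j : ℝ) ^ 2 * rs *
              (4 / (3 * ((Λ0 : ℝ) * G - K) ^ 2) + 2 / (P.N j * ((Λ0 : ℝ) * G - K))) +
            12 * (P.N j : ℝ) ^ 2 * ((qn : ℝ) * Λ0 / (((G : ℝ) * qd - qn) * Λ0 - K * qd)) ^ 2 *
              (4 * ((qn : ℝ) * Λ0 / qd) / (P.N j * ((Λ0 : ℝ) * G - K) ^ 2) +
                4 / (3 * ((Λ0 : ℝ) * G - K) ^ 2) + 2 / (P.N j * ((Λ0 : ℝ) * G - K)) +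
                Mb * (2 * ((qn : ℝ) * Λ0 / qd) / ((P.N j : ℝ) ^ 2 * ((Λ0 : ℝ) * G - K))))) / π ^ 2) +
          Real.sqrt (4 / 3 * (π * ((Λ0 : ℝ) * G) * ε * 2 ^ Mb / P.N j) ^ 2 + Mb * (8 * M * P.δ j / π * rs)) +
          Real.sqrt (∑' k : Fin 2 → ℤ, (if (Y : ℤ) ≤ |k 0| ∧ (u' : ℤ) * |k 1| ≤ (v' : ℤ) * |k 0| then (1 : ℝ) else 0) *
            ‖mFourierCoeff (fun x => (b j x : ℂ)) k‖ ^ 2)) ^ 2 +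
        ((1 + P.γ) ^ (2 * (j + 1)) / ((Λ0 * 2 ^ Mb : ℕ) : ℝ)) ^ 2) := by
  -- the canonical data
  have hN : (0 : ℝ) < P.N j := by exact_mod_cast P.N_pos hN₀ hρN j
  have hδ : 0 < P.δ j := P.δ_pos hδ₀ hd j
  have hε0 : 0 ≤ ε := (Real.exp_pos _).le.trans hε
  set Λb : ℕ → ℕ := fun m => Λ0 * 2 ^ m with hΛb
  set Q₂ : ℕ → ℕ := fun m => qn * (Λ0 * 2 ^ m) / qd with hQ₂
  set R : ℕ → ℕ := fun m => Q₂ m - Q₁ m with hRdef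
  set S₀ : ℝ := (Λ0 : ℝ) * G - K with hS₀
  set q₀ : ℝ := (qn : ℝ) * Λ0 / qd with hq₀
  set D₀ : ℝ := (((G : ℝ) * qd - qn) * Λ0 - K * qd) / qd with hD₀
  have hΛge : ∀ m, 1 ≤ Λ0 * 2 ^ m := fun m => hΛ0.trans (canon_blocks_ge Λ0 m)
  have hqdr : (0 : ℝ) < qd := by exact_mod_cast hqd
  have hΛ0r : (1 : ℝ) ≤ Λ0 := by exact_mod_cast hΛ0
  have hKr : (K : ℝ) * qd + qn * Λ0 < G * qd * Λ0 := by exact_mod_cast hK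
  have hc3 : (0 : ℝ) < ((G : ℝ) * qd - qn) * Λ0 - K * qd := by linarith
  have hD₀pos : 0 < D₀ := by positivity
  have hS₀pos : 0 < S₀ := by
    have hqn0 : (0 : ℝ) ≤ (qn : ℝ) * Λ0 := by positivity
    have h1 : 0 < ((Λ0 : ℝ) * G - K) * qd := by nlinarith
    exact (mul_pos_iff_of_pos_right hqdr).mp h1
  have hq₀0 : 0 ≤ q₀ := by positivity
  have eQR : ∀ m, Q₁ m + R m = Q₂ m := fun m => Nat.add_sub_cancel' (hQ m).le
  have hRpos : ∀ m, 0 < R m := fun m => Nat.sub_pos_of_lt (hQ m)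
  have hΛQ : ∀ m, K + (Q₁ m + R m) < Λb m * G := fun m => by
    rw [eQR]; exact canon_strip_shift hK (canon_blocks_ge Λ0 m)
  -- the multi-block step
  have hstep := tsum_strip_vstep_blocks_ct_le P hγ hδ₀ hd hN₀ hρN a b has h0 hb hab j K Λb
    (canon_blocks_monotone Λ0) (by simpa [hΛb] using hΛ0) Mb Q₁ R hRpos hΛQ hM hMδ hε
    (u' := u') (v' := v') (Y := Y) hfeed hY
  -- the block data of the junk lemma
  have hDge : ∀ m, D₀ * 2 ^ m ≤ ((Λb m * G : ℕ) : ℝ) - ((K + (Q₁ m + R m) : ℕ) : ℝ) := fun m => by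
    rw [eQR]
    have h := canon_strip_den_ge (G := G) hqd hK m
    have e : D₀ * 2 ^ m = (((G : ℝ) * qd - qn) * Λ0 - K * qd) * 2 ^ m / qd := by rw [hD₀]; ring
    rw [e]; exact h
  have hS : ∀ m, S₀ * 2 ^ m ≤ ((Λb m * G : ℕ) : ℝ) - ((K + (Q₁ m + R m) : ℕ) : ℝ) + ((Q₁ m + R m : ℕ) : ℝ) :=
    fun m => by
    have eΛ : ((Λb m * G : ℕ) : ℝ) = (Λ0 : ℝ) * 2 ^ m * G := by simp [hΛb]
    rw [eΛ, hS₀]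
    push_cast
    have h2m : (1 : ℝ) ≤ 2 ^ m := one_le_pow₀ (by norm_num)
    have hK0 : (0 : ℝ) ≤ K := by positivity
    nlinarith [mul_le_mul_of_nonneg_left h2m hK0]
  have hQ0' : ∀ m, (0 : ℝ) ≤ ((Q₁ m + R m : ℕ) : ℝ) := fun m => by positivity
  have hQle : ∀ m, ((Q₁ m + R m : ℕ) : ℝ) ≤ q₀ * 2 ^ m := fun m => by
    rw [eQR, hq₀]
    have h := canon_Q₂_le qn qd (Λ0 * 2 ^ m)
    have e : (qn : ℝ) / qd * ((Λ0 * 2 ^ m : ℕ) : ℝ) = (qn : ℝ) * Λ0 / qd * 2 ^ m := by push_cast; ring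
    rw [← e]; exact h
  have hT : ∀ m, (Real.sqrt ((2 * Q₁ m + R m : ℕ) * R m) / R m * 1) ^ 2 / 2 +
      (Real.sqrt ((2 * Q₁ m + R m : ℕ) * R m) / R m * 1) ^ 2 / 2 ≤ rs := fun m => by
    rw [boxTrace_halves_eq (Q₁ m) (hRpos m)]
    have e1 : 2 * Q₁ m + R m = Q₁ m + Q₂ m := by rw [two_mul, add_assoc, eQR]
    have e2 : ((R m : ℕ) : ℝ) = ((Q₂ m : ℕ) : ℝ) - ((Q₁ m : ℕ) : ℝ) := by
      rw [← eQR m, Nat.cast_add]; ring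
    rw [e1, Nat.cast_add, e2]
    exact hr m
  have hT0 : ∀ m, 0 ≤ (Real.sqrt ((2 * Q₁ m + R m : ℕ) * R m) / R m * 1) ^ 2 / 2 +
      (Real.sqrt ((2 * Q₁ m + R m : ℕ) * R m) / R m * 1) ^ 2 / 2 := fun m => by positivity
  have hΛ'0 : ∀ m, (0 : ℝ) ≤ ((Λb (m + 1) * G : ℕ) : ℝ) := fun m => by positivity
  have hΛ' : ∀ m, ((Λb (m + 1) * G : ℕ) : ℝ) ≤ (Λ0 : ℝ) * G * 2 ^ (m + 1) := fun m => by
    apply le_of_eq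
    simp [hΛb]
    ring
  -- the junk in closed form
  have hjunk := blockJunk_ct_sum_le (D := fun m => ((Λb m * G : ℕ) : ℝ) - ((K + (Q₁ m + R m) : ℕ) : ℝ))
    (Q := fun m => ((Q₁ m + R m : ℕ) : ℝ))
    (T := fun m => (Real.sqrt ((2 * Q₁ m + R m : ℕ) * R m) / R m * 1) ^ 2 / 2 +
      (Real.sqrt ((2 * Q₁ m + R m : ℕ) * R m) / R m * 1) ^ 2 / 2)
    (Λ' := fun m => ((Λb (m + 1) * G : ℕ) : ℝ)) (N := (P.N j : ℝ)) (D₀ := D₀) (S₀ := S₀) (q₀ := q₀) (rs := rs)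
    (ℓ₀ := (Λ0 : ℝ) * G) (ε := ε) (M := M) (δ := P.δ j) hN hD₀pos hS₀pos hq₀0 hε0 (by linarith) hδ.le
    hDge hS hQ0' hQle hT0 hT hΛ'0 hΛ' Mb
  beta_reduce at hjunk
  have eϑ : q₀ / D₀ = (qn : ℝ) * Λ0 / (((G : ℝ) * qd - qn) * Λ0 - K * qd) := by
    rw [hq₀, hD₀]
    field_simp
  rw [eϑ] at hjunk
  have e0 : Λb 0 = Λ0 := by simp [hΛb]
  rw [e0] at hstep
  exact le_add_sq_sqrt_add_of_sq hstep hjunk (add_nonneg (Real.sqrt_nonneg _) (Real.sqrt_nonneg _))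

/-! ## §2 The low fibres (T-H) on canonical blocks -/

/-- **(T-H) ON CANONICAL BLOCKS, CT GRADE.**  The low fibres `Σ'[|k₁| < K]‖𝓕b_j‖²`: the fibres `|k₀| < Λ₀` pass exactly, the
chopped fibres `k₀` are cut into canonical blocks from the floor `Λ₀ ≥ 1` (the strip threshold of `a_j`) with margin `q_n/q_d`,
`Kq_d + q_nΛ₀ < Gq_dΛ₀`; feed = the off-cone class `Σ'[Λ₀ ≤ |k₀| ∧ u′|k₀| ≤ v′|k₁|]‖𝓕a_j‖²`, lower cut-offs `Q₁^m < Q₂^m` with the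
feed inclusion and `r_m ≤ r*`, `M_b` blocks, zone parameter `M ≥ 1` with `Mδ_j < π/2`, rounding `ε ≥ e^{−M²/2}`.  Then
`T ≤ Σ'[|k₀| < Λ₀]‖𝓕a_j‖² + ((√J₁ + √J₂ + √feed)² + ((1+γ)^{2j}/(Λ₀2^{M_b}))²)` with `J₁`, `J₂` as in the file header.
[cite: Grafakos2014, Prop. 3.1.2 (5), Prop. 3.2.7 (3), §3.1.3] -/
theorem lowFibre_hstep_canonicalCT_le {G : ℕ} (hγ : P.γ = G) (hδ₀ : 0 < P.δ₀) (hd : 0 < P.d) (hN₀ : 1 ≤ P.N₀)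
    (hρN : 1 ≤ P.ρN) (a b : ℕ → UnitAddTorus (Fin 2) → ℝ) (has : ∀ j, IsSmooth (a j)) (h0 : a 0 = datum)
    (hb : ∀ j, b j = a j ∘ shearMap 0 1 (amp ⟨P.U j, P.U_periodic j, P.contDiff_U (P.δ_pos hδ₀ hd j)⟩ P.γ))
    (hab : ∀ j, a (j + 1) = b j ∘ shearMap 1 0 (amp ⟨P.U j, P.U_periodic j, P.contDiff_U (P.δ_pos hδ₀ hd j)⟩ P.γ))
    (j : ℕ) {K u' v' qn qd Λ0 : ℕ} (hqd : 0 < qd)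
    (hK : K * qd + qn * Λ0 < G * qd * Λ0) (hΛ0 : 1 ≤ Λ0)
    (Q₁ : ℕ → ℕ) (hQ : ∀ m, Q₁ m < qn * (Λ0 * 2 ^ m) / qd)
    (hfeed : ∀ m, u' * (Λ0 * 2 ^ (m + 1)) ≤ v' * (Q₁ m + 1)) {rs : ℝ}
    (hr : ∀ m, (((Q₁ m : ℕ) : ℝ) + ((qn * (Λ0 * 2 ^ m) / qd : ℕ) : ℝ)) /
      (((qn * (Λ0 * 2 ^ m) / qd : ℕ) : ℝ) - ((Q₁ m : ℕ) : ℝ)) ≤ rs)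
    (Mb : ℕ) {M ε : ℝ} (hM : 1 ≤ M) (hMδ : M * P.δ j < π / 2)
    (hε : Real.exp (-(M ^ 2 / 2)) ≤ ε) :
    ∑' k : Fin 2 → ℤ, (if |k 1| < (K : ℤ) then (1 : ℝ) else 0) * ‖mFourierCoeff (fun x => (b j x : ℂ)) k‖ ^ 2 ≤
      ∑' k : Fin 2 → ℤ, (if |k 0| < (Λ0 : ℤ) then (1 : ℝ) else 0) * ‖mFourierCoeff (fun x => (a j x : ℂ)) k‖ ^ 2 +
      ((Real.sqrt ((6 * (P.N j : ℝ) ^ 2 * rs *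
              (4 / (3 * ((Λ0 : ℝ) * G - K) ^ 2) + 2 / (P.N j * ((Λ0 : ℝ) * G - K))) +
            12 * (P.N j : ℝ) ^ 2 * ((qn : ℝ) * Λ0 / (((G : ℝ) * qd - qn) * Λ0 - K * qd)) ^ 2 *
              (4 * ((qn : ℝ) * Λ0 / qd) / (P.N j * ((Λ0 : ℝ) * G - K) ^ 2) +
                4 / (3 * ((Λ0 : ℝ) * G - K) ^ 2) + 2 / (P.N j * ((Λ0 : ℝ) * G - K)) +
                Mb * (2 * ((qn : ℝ) * Λ0 / qd) / ((P.N j : ℝ) ^ 2 * ((Λ0 : ℝ) * G - K))))) / π ^ 2) +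
          Real.sqrt (4 / 3 * (π * ((Λ0 : ℝ) * G) * ε * 2 ^ Mb / P.N j) ^ 2 + Mb * (8 * M * P.δ j / π * rs)) +
          Real.sqrt (∑' k : Fin 2 → ℤ, (if (Λ0 : ℤ) ≤ |k 0| ∧ (u' : ℤ) * |k 0| ≤ (v' : ℤ) * |k 1| then (1 : ℝ) else 0) *
            ‖mFourierCoeff (fun x => (a j x : ℂ)) k‖ ^ 2)) ^ 2 +
        ((1 + P.γ) ^ (2 * j) / ((Λ0 * 2 ^ Mb : ℕ) : ℝ)) ^ 2) := by
  -- the canonical data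
  have hN : (0 : ℝ) < P.N j := by exact_mod_cast P.N_pos hN₀ hρN j
  have hδ : 0 < P.δ j := P.δ_pos hδ₀ hd j
  have hε0 : 0 ≤ ε := (Real.exp_pos _).le.trans hε
  set Λb : ℕ → ℕ := fun m => Λ0 * 2 ^ m with hΛb
  set Q₂ : ℕ → ℕ := fun m => qn * (Λ0 * 2 ^ m) / qd with hQ₂
  set R : ℕ → ℕ := fun m => Q₂ m - Q₁ m with hRdef
  set S₀ : ℝ := (Λ0 : ℝ) * G - K with hS₀
  set q₀ : ℝ := (qn : ℝ) * Λ0 / qd with hq₀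
  set D₀ : ℝ := (((G : ℝ) * qd - qn) * Λ0 - K * qd) / qd with hD₀
  have hΛge : ∀ m, 1 ≤ Λ0 * 2 ^ m := fun m => hΛ0.trans (canon_blocks_ge Λ0 m)
  have hqdr : (0 : ℝ) < qd := by exact_mod_cast hqd
  have hΛ0r : (1 : ℝ) ≤ Λ0 := by exact_mod_cast hΛ0
  have hKr : (K : ℝ) * qd + qn * Λ0 < G * qd * Λ0 := by exact_mod_cast hK
  have hc3 : (0 : ℝ) < ((G : ℝ) * qd - qn) * Λ0 - K * qd := by linarith
  have hD₀pos : 0 < D₀ := by positivity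
  have hS₀pos : 0 < S₀ := by
    have hqn0 : (0 : ℝ) ≤ (qn : ℝ) * Λ0 := by positivity
    have h1 : 0 < ((Λ0 : ℝ) * G - K) * qd := by nlinarith
    exact (mul_pos_iff_of_pos_right hqdr).mp h1
  have hq₀0 : 0 ≤ q₀ := by positivity
  have eQR : ∀ m, Q₁ m + R m = Q₂ m := fun m => Nat.add_sub_cancel' (hQ m).le
  have hRpos : ∀ m, 0 < R m := fun m => Nat.sub_pos_of_lt (hQ m)
  have hΛQ : ∀ m, K + (Q₁ m + R m) < Λb m * G := fun m => by
    rw [eQR]; exact canon_strip_shift hK (canon_blocks_ge Λ0 m)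
  -- the multi-block step
  have hstep := tsum_lowFibre_hstep_blocks_ct_le P hγ hδ₀ hd hN₀ hρN a b has h0 hb hab j K Λb
    (canon_blocks_monotone Λ0) (by simpa [hΛb] using hΛ0) Mb Q₁ R hRpos hΛQ hM hMδ hε
    (u' := u') (v' := v') hfeed
  -- the block data of the junk lemma
  have hDge : ∀ m, D₀ * 2 ^ m ≤ ((Λb m * G : ℕ) : ℝ) - ((K + (Q₁ m + R m) : ℕ) : ℝ) := fun m => by
    rw [eQR]
    have h := canon_strip_den_ge (G := G) hqd hK m
    have e : D₀ * 2 ^ m = (((G : ℝ) * qd - qn) * Λ0 - K * qd) * 2 ^ m / qd := by rw [hD₀]; ring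
    rw [e]; exact h
  have hS : ∀ m, S₀ * 2 ^ m ≤ ((Λb m * G : ℕ) : ℝ) - ((K + (Q₁ m + R m) : ℕ) : ℝ) + ((Q₁ m + R m : ℕ) : ℝ) :=
    fun m => by
    have eΛ : ((Λb m * G : ℕ) : ℝ) = (Λ0 : ℝ) * 2 ^ m * G := by simp [hΛb]
    rw [eΛ, hS₀]
    push_cast
    have h2m : (1 : ℝ) ≤ 2 ^ m := one_le_pow₀ (by norm_num)
    have hK0 : (0 : ℝ) ≤ K := by positivity
    nlinarith [mul_le_mul_of_nonneg_left h2m hK0]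
  have hQ0' : ∀ m, (0 : ℝ) ≤ ((Q₁ m + R m : ℕ) : ℝ) := fun m => by positivity
  have hQle : ∀ m, ((Q₁ m + R m : ℕ) : ℝ) ≤ q₀ * 2 ^ m := fun m => by
    rw [eQR, hq₀]
    have h := canon_Q₂_le qn qd (Λ0 * 2 ^ m)
    have e : (qn : ℝ) / qd * ((Λ0 * 2 ^ m : ℕ) : ℝ) = (qn : ℝ) * Λ0 / qd * 2 ^ m := by push_cast; ring
    rw [← e]; exact h
  have hT : ∀ m, (Real.sqrt ((2 * Q₁ m + R m : ℕ) * R m) / R m * 1) ^ 2 / 2 +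
      (Real.sqrt ((2 * Q₁ m + R m : ℕ) * R m) / R m * 1) ^ 2 / 2 ≤ rs := fun m => by
    rw [boxTrace_halves_eq (Q₁ m) (hRpos m)]
    have e1 : 2 * Q₁ m + R m = Q₁ m + Q₂ m := by rw [two_mul, add_assoc, eQR]
    have e2 : ((R m : ℕ) : ℝ) = ((Q₂ m : ℕ) : ℝ) - ((Q₁ m : ℕ) : ℝ) := by
      rw [← eQR m, Nat.cast_add]; ring
    rw [e1, Nat.cast_add, e2]
    exact hr m
  have hT0 : ∀ m, 0 ≤ (Real.sqrt ((2 * Q₁ m + R m : ℕ) * R m) / R m * 1) ^ 2 / 2 +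
      (Real.sqrt ((2 * Q₁ m + R m : ℕ) * R m) / R m * 1) ^ 2 / 2 := fun m => by positivity
  have hΛ'0 : ∀ m, (0 : ℝ) ≤ ((Λb (m + 1) * G : ℕ) : ℝ) := fun m => by positivity
  have hΛ' : ∀ m, ((Λb (m + 1) * G : ℕ) : ℝ) ≤ (Λ0 : ℝ) * G * 2 ^ (m + 1) := fun m => by
    apply le_of_eq
    simp [hΛb]
    ring
  -- the junk in closed form
  have hjunk := blockJunk_ct_sum_le (D := fun m => ((Λb m * G : ℕ) : ℝ) - ((K + (Q₁ m + R m) : ℕ) : ℝ))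
    (Q := fun m => ((Q₁ m + R m : ℕ) : ℝ))
    (T := fun m => (Real.sqrt ((2 * Q₁ m + R m : ℕ) * R m) / R m * 1) ^ 2 / 2 +
      (Real.sqrt ((2 * Q₁ m + R m : ℕ) * R m) / R m * 1) ^ 2 / 2)
    (Λ' := fun m => ((Λb (m + 1) * G : ℕ) : ℝ)) (N := (P.N j : ℝ)) (D₀ := D₀) (S₀ := S₀) (q₀ := q₀) (rs := rs)
    (ℓ₀ := (Λ0 : ℝ) * G) (ε := ε) (M := M) (δ := P.δ j) hN hD₀pos hS₀pos hq₀0 hε0 (by linarith) hδ.le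
    hDge hS hQ0' hQle hT0 hT hΛ'0 hΛ' Mb
  beta_reduce at hjunk
  have eϑ : q₀ / D₀ = (qn : ℝ) * Λ0 / (((G : ℝ) * qd - qn) * Λ0 - K * qd) := by
    rw [hq₀, hD₀]
    field_simp
  rw [eϑ] at hjunk
  have e0 : Λb 0 = Λ0 := by simp [hΛb]
  rw [e0] at hstep
  exact le_add_sq_sqrt_add_of_sq hstep hjunk (add_nonneg (Real.sqrt_nonneg _) (Real.sqrt_nonneg _))

end Cascade

end Summit.AnomalousDissipation.AnomalousDissipation.Theorems.SawtoothPulseCascade.K1Window
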